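import Summits.QuantumFields.YangMills.Theorems.VirialFluxGapRingTreeGaugeZeroSet
import Summits.QuantumFields.YangMills.Theorems.ToronValleyVolumeLojasiewiczLocaliseRing
import HarnessLib

/-!
# Floor transfer to the tree gauge: every zero of `F_z` near a slice-0-comb-gauged ring history has a COMB-GAUGED zero `poly(L)`-near it
# (layer (B2)∕(D) junction of the DIRECT Laplace road to ⟨stmt-QuantumFields-24204⟩: the input `hfloor` of ✓`sharpTwistedLaplace_of_fixTubes`
# from ✓`ringDeficit_floor_off_tube`)

Helper module (free-hands work of width seat ym-line-sfw-p2-w2 g49, cell ym-idea-1).  With the squared chordal ring distance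
`D(P,Q) = Σ_i (6L³ − timeCoupling(P_i,Q_i)) + Σ_x (2 − Re tr(P.2 x (Q.2 x)⁻¹)) = Σ_{i,e} ‖q(P_i e) − q(Q_i e)‖² + Σ_x ‖q(P.2 x) − q(Q.2 x)‖²` of ✓⟨24320⟩:
* `norm_su2Quat_conj_sub_le` — `‖q(A V B⁻¹) − q(V)‖ ≤ ‖q(A) − 1‖ + ‖q(B) − 1‖`;
* `norm_su2Quat_treeGauge_sub_one_le` — if the tree links of `P₀` are `1`, the comb transporter `τ = treeGauge Q₀` satisfies
  `‖q(τ y) − 1‖ ≤ 3(L−1)·√(6L³ − timeCoupling(P₀,Q₀))` (✓`fd_sub_base_le_of_treeEdge`);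
* ★ `ringDistSq_treeGauge_le` — for `P` with slice-0 tree links `1` and ANY `Q`, the gauge transform `τ·Q` by `τ = treeGauge (Q.1 0)` has
  `D(P, τ·Q) ≤ 1010·L⁶·D(P, Q)`; `τ·Q` is slice-0 comb-gauged (`treeFix_eq_one_of_treeEdge`) and a zero of `F_z` iff `Q` is (✓`ringDeficit_ringGaugeAct`);
* ★ `sInf_ringDistSq_combGauged_zero_le` — hence `inf_{Q ∈ Z, Q comb-gauged} D(P,Q) ≤ 1010 L⁶ · inf_{Q ∈ Z} D(P,Q)`: the off-tube floor of ✓`ringDeficit_floor_off_tube`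
  transfers to the tree-gauged space `X_fix` of ✓`VirialFluxGapRingTreeGauge` with a polynomial loss.
Everything is PROVED; no definitions, no named facts.  HONEST FRAMING: bookkeeping; ⟨24204⟩, ⟨24319⟩ and every rung stay OPEN; the Yang–Mills mass
gap (Clay) is NOT touched; no summit is proved by a line.
-/

noncomputable section

open scoped Quaternion Matrix BigOperators
open Literature.MathematicalPhysics.QuantumFieldTheory hiding SU2 su2Quat_mul
open Literature.MathematicalPhysics.QuantumLattice
open Literature.MathematicalPhysics.QuantumFieldTheory.Balaban1983to89.T4HaarSU2Translate (su2Quat_mul)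
open Summit.QuantumFields.YangMills.Theorems.FemtoTransferGap
open Summit.QuantumFields.YangMills.Theorems.FemtoTransferGap.TT
open Summit.QuantumFields.YangMills.Theorems.FemtoTransferGap.TwoLattice
open Summit.QuantumFields.YangMills.Theorems.FemtoTransferGap.TwoLattice.Flat
open Summit.QuantumFields.YangMills.Theorems.FemtoTransferGap.TwoLattice.ConstTube (re_trace_su2Rep_mul_inv_eq_norm)
open Summit.QuantumFields.YangMills.Theorems.ToronValleyVolume.Lojasiewicz

namespace Summit.QuantumFields.YangMills.Theorems.VirialFluxGap.RingDeficit

variable {L : ℕ} [NeZero L]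

/-! ## §1 Quaternion bookkeeping -/

omit [NeZero L] in
/-- `‖q(A V B⁻¹) − q(V)‖ ≤ ‖q(A) − 1‖ + ‖q(B) − 1‖`. [folklore] -/
theorem norm_su2Quat_conj_sub_le (A V B : SU2) :
    ‖su2Quat (A * V * B⁻¹) - su2Quat V‖ ≤ ‖su2Quat A - 1‖ + ‖su2Quat B - 1‖ := by
  have hBinv : su2Quat B⁻¹ * su2Quat B = 1 := by rw [← su2Quat_mul, inv_mul_cancel, FemtoTransferGap.su2Quat_one]
  have e : su2Quat (A * V * B⁻¹) - su2Quat V =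
      (su2Quat A - 1) * su2Quat V * su2Quat B⁻¹ + su2Quat V * (su2Quat B⁻¹ * (1 - su2Quat B)) := by
    rw [su2Quat_mul, su2Quat_mul, mul_sub, mul_one, hBinv]; noncomm_ring
  rw [e]
  refine (norm_add_le _ _).trans (add_le_add ?_ ?_)
  · rw [norm_mul, norm_mul, norm_su2Quat, norm_su2Quat, mul_one, mul_one]
  · rw [norm_mul, norm_mul, norm_su2Quat, norm_su2Quat, one_mul, one_mul, norm_sub_rev]

/-! ## §2 The comb transporter of a nearby slice is close to `1` -/

/-- If the tree links of `P₀` are trivial, the comb transporter of `Q₀` is within `3(L−1)·√(2(6L³ − timeCoupling(P₀,Q₀)))` of `1` in Frobenius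
distance at every site. [folklore] -/
theorem fd_treeGauge_one_le {P₀ Q₀ : GaugeConfig 3 L SU2} (hP : ∀ e : Edge 3 L, treeEdge e = true → P₀ e = 1) (y : Site 3 L) :
    fd (treeGauge Q₀ y) 1 ≤ 3 * ((L : ℝ) - 1) * Real.sqrt (2 * (6 * (L : ℝ) ^ 3 - timeCoupling su2Rep P₀ Q₀)) := by
  have hclimb : ∀ e : Edge 3 L, treeEdge e = true →
      fd (treeGauge Q₀ (e.1.shift e.2)) (treeGauge Q₀ e.1) ≤ Real.sqrt (2 * (6 * (L : ℝ) ^ 3 - timeCoupling su2Rep P₀ Q₀)) := by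
    intro e he
    have h1 : treeGauge Q₀ e.1 * Q₀ e * (treeGauge Q₀ (e.1.shift e.2))⁻¹ = 1 := treeFix_eq_one_of_treeEdge Q₀ he
    have h2 : treeGauge Q₀ (e.1.shift e.2) = treeGauge Q₀ e.1 * Q₀ e := by
      rw [mul_inv_eq_one] at h1; exact h1.symm
    rw [h2, ← mul_one (treeGauge Q₀ e.1), mul_assoc, one_mul, fd_mul_left, ← hP e he]
    -- `fd (Q₀ e) (P₀ e) ≤ √(2 D₀)`
    have hsq : fd (Q₀ e) (P₀ e) ^ 2 ≤ 2 * (6 * (L : ℝ) ^ 3 - timeCoupling su2Rep P₀ Q₀) := by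
      rw [fd_sq_eq_two_mul, norm_sub_rev]
      exact mul_le_mul_of_nonneg_left (norm_sq_le_timeCoupling_deficit P₀ Q₀ e) (by norm_num)
    have h0 : 0 ≤ fd (Q₀ e) (P₀ e) := by unfold fd frobNorm; positivity
    exact Real.le_sqrt_of_sq_le hsq |> fun h => by simpa using h
  have h := fd_sub_base_le_of_treeEdge (g := treeGauge Q₀) (Real.sqrt_nonneg _) hclimb y
  rwa [treeGauge_zero] at h

/-- Quaternion form: `‖q(τ y) − 1‖ ≤ 3(L−1)·√(2 D₀)`. [folklore] -/
theorem norm_su2Quat_treeGauge_sub_one_le {P₀ Q₀ : GaugeConfig 3 L SU2} (hP : ∀ e : Edge 3 L, treeEdge e = true → P₀ e = 1) (y : Site 3 L) :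
    ‖su2Quat (treeGauge Q₀ y) - 1‖ ≤ 3 * ((L : ℝ) - 1) * Real.sqrt (2 * (6 * (L : ℝ) ^ 3 - timeCoupling su2Rep P₀ Q₀)) := by
  have h := (norm_su2Quat_sub_le_fd (treeGauge Q₀ y) 1).trans (fd_treeGauge_one_le hP y)
  rwa [FemtoTransferGap.su2Quat_one] at h

/-! ## §3 The transfer inequality -/

/-- ★ **Comb-gauging a nearby ring history costs a polynomial factor**: for `P` with slice-0 tree links `1` and any `Q`, with `τ = treeGauge (Q.1 0)`,
`D(P, τ·Q) ≤ 1010·L⁶·D(P, Q)`. [folklore] -/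
theorem ringDistSq_treeGauge_le (P Q : (Fin (2 * L - 1 + 1) → GaugeConfig 3 L SU2) × (Site 3 L → SU2))
    (hP : ∀ e : Edge 3 L, treeEdge e = true → P.1 0 e = 1) :
    ((∑ i : Fin (2 * L - 1 + 1), (6 * (L : ℝ) ^ 3 - timeCoupling su2Rep (P.1 i)
        (gaugeTransform (treeGauge (Q.1 0)) (Q.1 i)))) +
      ∑ x : Site 3 L, (2 - ((su2Rep (P.2 x * ((treeGauge (Q.1 0) * Q.2 * (treeGauge (Q.1 0))⁻¹) x)⁻¹)).trace).re)) ≤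
      1010 * (L : ℝ) ^ 6 *
        ((∑ i : Fin (2 * L - 1 + 1), (6 * (L : ℝ) ^ 3 - timeCoupling su2Rep (P.1 i) (Q.1 i))) +
          ∑ x : Site 3 L, (2 - ((su2Rep (P.2 x * (Q.2 x)⁻¹)).trace).re)) := by
  set τ : Site 3 L → SU2 := treeGauge (Q.1 0) with hτ
  set D : ℝ := (∑ i : Fin (2 * L - 1 + 1), (6 * (L : ℝ) ^ 3 - timeCoupling su2Rep (P.1 i) (Q.1 i))) +
      ∑ x : Site 3 L, (2 - ((su2Rep (P.2 x * (Q.2 x)⁻¹)).trace).re) with hD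
  have hL1 : (1 : ℝ) ≤ L := by exact_mod_cast Nat.one_le_iff_ne_zero.mpr (NeZero.ne L)
  -- the seam terms as squared quaternion distances
  have hseam : ∀ (g g' : Site 3 L → SU2) (x : Site 3 L),
      2 - ((su2Rep (g x * (g' x)⁻¹)).trace).re = ‖su2Quat (g x) - su2Quat (g' x)‖ ^ 2 := fun g g' x => by
    rw [re_trace_su2Rep_mul_inv_eq_norm]; ring
  -- nonnegativity and the single-term bounds
  have hDslice : ∀ i e, ‖su2Quat (P.1 i e) - su2Quat (Q.1 i e)‖ ^ 2 ≤ D := by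
    intro i e
    have h1 := norm_sq_le_timeCoupling_deficit (P.1 i) (Q.1 i) e
    have h2 : 6 * (L : ℝ) ^ 3 - timeCoupling su2Rep (P.1 i) (Q.1 i) ≤
        ∑ i : Fin (2 * L - 1 + 1), (6 * (L : ℝ) ^ 3 - timeCoupling su2Rep (P.1 i) (Q.1 i)) :=
      Finset.single_le_sum (f := fun i => 6 * (L : ℝ) ^ 3 - timeCoupling su2Rep (P.1 i) (Q.1 i))
        (fun j _ => by rw [timeCoupling_deficit_eq]; positivity) (Finset.mem_univ i)
    have h3 : 0 ≤ ∑ x : Site 3 L, (2 - ((su2Rep (P.2 x * (Q.2 x)⁻¹)).trace).re) :=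
      Finset.sum_nonneg fun x _ => by rw [hseam]; positivity
    rw [hD]; linarith
  have hD0 : 0 ≤ D := (sq_nonneg _).trans (hDslice 0 ((0 : Site 3 L), (0 : Fin 3)))
  have hD₀ : 6 * (L : ℝ) ^ 3 - timeCoupling su2Rep (P.1 0) (Q.1 0) ≤ D := by
    have h2 : 6 * (L : ℝ) ^ 3 - timeCoupling su2Rep (P.1 0) (Q.1 0) ≤
        ∑ i : Fin (2 * L - 1 + 1), (6 * (L : ℝ) ^ 3 - timeCoupling su2Rep (P.1 i) (Q.1 i)) :=
      Finset.single_le_sum (f := fun i => 6 * (L : ℝ) ^ 3 - timeCoupling su2Rep (P.1 i) (Q.1 i))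
        (fun j _ => by rw [timeCoupling_deficit_eq]; positivity) (Finset.mem_univ 0)
    have h3 : 0 ≤ ∑ x : Site 3 L, (2 - ((su2Rep (P.2 x * (Q.2 x)⁻¹)).trace).re) :=
      Finset.sum_nonneg fun x _ => by rw [hseam]; positivity
    rw [hD]; linarith
  -- the transporter is close to `1`: `‖q(τ y) − 1‖ ≤ 3(L−1)√(2D)`
  have hτ1 : ∀ y, ‖su2Quat (τ y) - 1‖ ≤ 3 * ((L : ℝ) - 1) * Real.sqrt (2 * D) := by
    intro y
    refine (norm_su2Quat_treeGauge_sub_one_le (P₀ := P.1 0) (Q₀ := Q.1 0) hP y).trans ?_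
    exact mul_le_mul_of_nonneg_left (Real.sqrt_le_sqrt (by linarith)) (by nlinarith)
  have hB : 0 ≤ 3 * ((L : ℝ) - 1) * Real.sqrt (2 * D) := by have := Real.sqrt_nonneg (2 * D); nlinarith
  have hB2 : (3 * ((L : ℝ) - 1) * Real.sqrt (2 * D)) ^ 2 = 18 * ((L : ℝ) - 1) ^ 2 * D := by
    rw [mul_pow, Real.sq_sqrt (by linarith)]; ring
  -- per-component estimate: `‖qP − q(A Q B⁻¹)‖² ≤ 2‖qP − qQ‖² + 2(‖qA − 1‖ + ‖qB − 1‖)² ≤ 2‖qP − qQ‖² + 144(L−1)²D`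
  have hcomp : ∀ (X Y A B : SU2), ‖su2Quat X - su2Quat (A * Y * B⁻¹)‖ ^ 2 ≤
      2 * ‖su2Quat X - su2Quat Y‖ ^ 2 + 2 * (‖su2Quat A - 1‖ + ‖su2Quat B - 1‖) ^ 2 := by
    intro X Y A B
    have h1 : ‖su2Quat X - su2Quat (A * Y * B⁻¹)‖ ≤ ‖su2Quat X - su2Quat Y‖ + (‖su2Quat A - 1‖ + ‖su2Quat B - 1‖) := by
      calc ‖su2Quat X - su2Quat (A * Y * B⁻¹)‖
          ≤ ‖su2Quat X - su2Quat Y‖ + ‖su2Quat Y - su2Quat (A * Y * B⁻¹)‖ := norm_sub_le_norm_sub_add_norm_sub _ _ _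
        _ ≤ ‖su2Quat X - su2Quat Y‖ + (‖su2Quat A - 1‖ + ‖su2Quat B - 1‖) := by
            rw [norm_sub_rev (su2Quat Y)]; exact add_le_add le_rfl (norm_su2Quat_conj_sub_le A Y B)
    have h0 : 0 ≤ ‖su2Quat X - su2Quat (A * Y * B⁻¹)‖ := norm_nonneg _
    have h2 := mul_le_mul h1 h1 h0 (by positivity)
    nlinarith [h2, sq_nonneg (‖su2Quat X - su2Quat Y‖ - (‖su2Quat A - 1‖ + ‖su2Quat B - 1‖))]
  have hpair : ∀ y y' : Site 3 L, 2 * (‖su2Quat (τ y) - 1‖ + ‖su2Quat (τ y') - 1‖) ^ 2 ≤ 144 * ((L : ℝ) - 1) ^ 2 * D := by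
    intro y y'
    have h1 : ‖su2Quat (τ y) - 1‖ + ‖su2Quat (τ y') - 1‖ ≤ 2 * (3 * ((L : ℝ) - 1) * Real.sqrt (2 * D)) := by
      linarith [hτ1 y, hτ1 y']
    have h0 : 0 ≤ ‖su2Quat (τ y) - 1‖ + ‖su2Quat (τ y') - 1‖ := by positivity
    have h2 := pow_le_pow_left₀ h0 h1 2
    nlinarith [h2, hB2]
  -- slices
  have hslices : ∀ i : Fin (2 * L - 1 + 1),
      6 * (L : ℝ) ^ 3 - timeCoupling su2Rep (P.1 i) (gaugeTransform τ (Q.1 i)) ≤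
        2 * (6 * (L : ℝ) ^ 3 - timeCoupling su2Rep (P.1 i) (Q.1 i)) + 3 * (L : ℝ) ^ 3 * (144 * ((L : ℝ) - 1) ^ 2 * D) := by
    intro i
    rw [timeCoupling_deficit_eq, timeCoupling_deficit_eq, Finset.mul_sum]
    have hcard : (3 : ℝ) * (L : ℝ) ^ 3 * (144 * ((L : ℝ) - 1) ^ 2 * D) = ∑ _e : Edge 3 L, 144 * ((L : ℝ) - 1) ^ 2 * D := by
      rw [Finset.sum_const, Finset.card_univ, nsmul_eq_mul, ConstTube.card_edge_three L]
    rw [hcard, ← Finset.sum_add_distrib]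
    refine Finset.sum_le_sum fun e _ => ?_
    unfold gaugeTransform
    exact (hcomp (P.1 i e) (Q.1 i e) (τ e.1) (τ (e.1.shift e.2))).trans (by linarith [hpair e.1 (e.1.shift e.2)])
  -- seam
  have hseams : ∀ x : Site 3 L,
      2 - ((su2Rep (P.2 x * ((τ * Q.2 * τ⁻¹) x)⁻¹)).trace).re ≤
        2 * (2 - ((su2Rep (P.2 x * (Q.2 x)⁻¹)).trace).re) + 144 * ((L : ℝ) - 1) ^ 2 * D := by
    intro x
    rw [hseam, hseam, Pi.mul_apply, Pi.mul_apply, Pi.inv_apply]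
    exact (hcomp (P.2 x) (Q.2 x) (τ x) (τ x)).trans (by linarith [hpair x x])
  -- sum up
  have hsumslices : (∑ i : Fin (2 * L - 1 + 1), (6 * (L : ℝ) ^ 3 - timeCoupling su2Rep (P.1 i) (gaugeTransform τ (Q.1 i)))) ≤
      2 * (∑ i : Fin (2 * L - 1 + 1), (6 * (L : ℝ) ^ 3 - timeCoupling su2Rep (P.1 i) (Q.1 i))) +
        (2 * L - 1 + 1 : ℕ) * (3 * (L : ℝ) ^ 3 * (144 * ((L : ℝ) - 1) ^ 2 * D)) := by
    have h := Finset.sum_le_sum fun i (_ : i ∈ (Finset.univ : Finset (Fin (2 * L - 1 + 1)))) => hslices i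
    rw [Finset.sum_add_distrib, ← Finset.mul_sum, Finset.sum_const, Finset.card_univ, Fintype.card_fin, nsmul_eq_mul] at h
    exact h
  have hsumseam : (∑ x : Site 3 L, (2 - ((su2Rep (P.2 x * ((τ * Q.2 * τ⁻¹) x)⁻¹)).trace).re)) ≤
      2 * (∑ x : Site 3 L, (2 - ((su2Rep (P.2 x * (Q.2 x)⁻¹)).trace).re)) + (Fintype.card (Site 3 L) : ℝ) * (144 * ((L : ℝ) - 1) ^ 2 * D) := by
    have h := Finset.sum_le_sum fun x (_ : x ∈ (Finset.univ : Finset (Site 3 L))) => hseams x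
    rw [Finset.sum_add_distrib, ← Finset.mul_sum, Finset.sum_const, Finset.card_univ, nsmul_eq_mul] at h
    exact h
  have hcardS : (Fintype.card (Site 3 L) : ℝ) = (L : ℝ) ^ 3 := ConstTube.card_site_cube L
  have hslN : ((2 * L - 1 + 1 : ℕ) : ℝ) = 2 * (L : ℝ) := by
    have : 2 * L - 1 + 1 = 2 * L := by have := NeZero.ne L; omega
    rw [this]; push_cast; ring
  rw [hcardS] at hsumseam
  rw [hslN] at hsumslices
  -- polynomial bookkeeping: `2D + (2L·3L³ + L³)·144(L−1)²·D ≤ 1010 L⁶ D`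
  have h1 : ((L : ℝ) - 1) ^ 2 ≤ (L : ℝ) ^ 2 := by nlinarith
  have hL5 : (L : ℝ) ^ 5 ≤ (L : ℝ) ^ 6 := pow_le_pow_right₀ hL1 (by norm_num)
  have e1 : 2 * (L : ℝ) * (3 * (L : ℝ) ^ 3 * (144 * ((L : ℝ) - 1) ^ 2 * D)) ≤ 864 * (L : ℝ) ^ 6 * D := by
    have e : 2 * (L : ℝ) * (3 * (L : ℝ) ^ 3 * (144 * ((L : ℝ) - 1) ^ 2 * D)) = 864 * ((L : ℝ) ^ 4 * D) * ((L : ℝ) - 1) ^ 2 := by ring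
    rw [e]
    have h2 : 864 * ((L : ℝ) ^ 4 * D) * ((L : ℝ) - 1) ^ 2 ≤ 864 * ((L : ℝ) ^ 4 * D) * (L : ℝ) ^ 2 :=
      mul_le_mul_of_nonneg_left h1 (by positivity)
    have e' : 864 * ((L : ℝ) ^ 4 * D) * (L : ℝ) ^ 2 = 864 * (L : ℝ) ^ 6 * D := by ring
    linarith
  have e2 : (L : ℝ) ^ 3 * (144 * ((L : ℝ) - 1) ^ 2 * D) ≤ 144 * (L : ℝ) ^ 6 * D := by
    have e : (L : ℝ) ^ 3 * (144 * ((L : ℝ) - 1) ^ 2 * D) = 144 * ((L : ℝ) ^ 3 * D) * ((L : ℝ) - 1) ^ 2 := by ring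
    rw [e]
    have h2 : 144 * ((L : ℝ) ^ 3 * D) * ((L : ℝ) - 1) ^ 2 ≤ 144 * ((L : ℝ) ^ 3 * D) * (L : ℝ) ^ 2 :=
      mul_le_mul_of_nonneg_left h1 (by positivity)
    have h3 : 144 * ((L : ℝ) ^ 3 * D) * (L : ℝ) ^ 2 = 144 * ((L : ℝ) ^ 5 * D) := by ring
    have h4 : (L : ℝ) ^ 5 * D ≤ (L : ℝ) ^ 6 * D := mul_le_mul_of_nonneg_right hL5 hD0
    linarith
  have e3 : 2 * D ≤ 2 * (L : ℝ) ^ 6 * D := by nlinarith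
  -- (note `2·D + 864 L⁶ D + 144 L⁶ D ≤ 1010 L⁶ D`; we bound the slice∕seam sums by `2·` their `D`-parts, which add to `2D`)
  have htot : (∑ i : Fin (2 * L - 1 + 1), (6 * (L : ℝ) ^ 3 - timeCoupling su2Rep (P.1 i) (gaugeTransform τ (Q.1 i)))) +
      (∑ x : Site 3 L, (2 - ((su2Rep (P.2 x * ((τ * Q.2 * τ⁻¹) x)⁻¹)).trace).re)) ≤ 1010 * (L : ℝ) ^ 6 * D := by
    have hsum : 2 * (∑ i : Fin (2 * L - 1 + 1), (6 * (L : ℝ) ^ 3 - timeCoupling su2Rep (P.1 i) (Q.1 i))) +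
        2 * (∑ x : Site 3 L, (2 - ((su2Rep (P.2 x * (Q.2 x)⁻¹)).trace).re)) = 2 * D := by rw [hD]; ring
    linarith
  exact htot

/-! ## §4 The infimum form: the off-tube floor transfers to comb-gauged zeros -/

/-- The squared chordal ring distance is non-negative. [folklore] -/
theorem ringDistSq_nonneg (P Q : (Fin (2 * L - 1 + 1) → GaugeConfig 3 L SU2) × (Site 3 L → SU2)) :
    0 ≤ (∑ i : Fin (2 * L - 1 + 1), (6 * (L : ℝ) ^ 3 - timeCoupling su2Rep (P.1 i) (Q.1 i))) +
      ∑ x : Site 3 L, (2 - ((su2Rep (P.2 x * (Q.2 x)⁻¹)).trace).re) := by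
  refine add_nonneg (Finset.sum_nonneg fun i _ => by rw [timeCoupling_deficit_eq]; positivity)
    (Finset.sum_nonneg fun x _ => ?_)
  rw [re_trace_su2Rep_mul_inv_eq_norm]
  nlinarith [norm_nonneg (su2Quat (P.2 x) - su2Quat (Q.2 x))]

/-- ★ **Floor transfer**: for `P` with slice-0 tree links `1`, the infimum of the squared chordal distance over the COMB-GAUGED zeros of `F_z` is at most
`1010·L⁶` times the infimum over all zeros (so ✓`ringDeficit_floor_off_tube` applies on the tree-gauged space with `ρ ↦ ρ/(1010L⁶)`).
[folklore] -/
theorem sInf_ringDistSq_combGauged_zero_le (z : Fin 3 → Bool) (P : (Fin (2 * L - 1 + 1) → GaugeConfig 3 L SU2) × (Site 3 L → SU2))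
    (hP : ∀ e : Edge 3 L, treeEdge e = true → P.1 0 e = 1) (hne : {Q | ringDeficit L z Q = 0}.Nonempty) :
    sInf ((fun Q : (Fin (2 * L - 1 + 1) → GaugeConfig 3 L SU2) × (Site 3 L → SU2) =>
        (∑ i : Fin (2 * L - 1 + 1), (6 * (L : ℝ) ^ 3 - timeCoupling su2Rep (P.1 i) (Q.1 i))) +
          ∑ x : Site 3 L, (2 - ((su2Rep (P.2 x * (Q.2 x)⁻¹)).trace).re)) ''
        {Q | ringDeficit L z Q = 0 ∧ ∀ e : Edge 3 L, treeEdge e = true → Q.1 0 e = 1}) ≤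
      1010 * (L : ℝ) ^ 6 *
        sInf ((fun Q : (Fin (2 * L - 1 + 1) → GaugeConfig 3 L SU2) × (Site 3 L → SU2) =>
          (∑ i : Fin (2 * L - 1 + 1), (6 * (L : ℝ) ^ 3 - timeCoupling su2Rep (P.1 i) (Q.1 i))) +
            ∑ x : Site 3 L, (2 - ((su2Rep (P.2 x * (Q.2 x)⁻¹)).trace).re)) '' {Q | ringDeficit L z Q = 0}) := by
  set Dst : (Fin (2 * L - 1 + 1) → GaugeConfig 3 L SU2) × (Site 3 L → SU2) → ℝ := fun Q =>
    (∑ i : Fin (2 * L - 1 + 1), (6 * (L : ℝ) ^ 3 - timeCoupling su2Rep (P.1 i) (Q.1 i))) +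
      ∑ x : Site 3 L, (2 - ((su2Rep (P.2 x * (Q.2 x)⁻¹)).trace).re) with hDst
  have hL1 : (1 : ℝ) ≤ L := by exact_mod_cast Nat.one_le_iff_ne_zero.mpr (NeZero.ne L)
  have hc : 0 < 1010 * (L : ℝ) ^ 6 := by positivity
  have hbddT : BddBelow (Dst '' {Q | ringDeficit L z Q = 0 ∧ ∀ e : Edge 3 L, treeEdge e = true → Q.1 0 e = 1}) :=
    ⟨0, by rintro _ ⟨Q, -, rfl⟩; exact ringDistSq_nonneg P Q⟩
  -- for every zero `Q`, its comb-gauged version `τ·Q` is a comb-gauged zero with `Dst(τ·Q) ≤ c·Dst(Q)`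
  have hkey : ∀ Q ∈ {Q | ringDeficit L z Q = 0},
      sInf (Dst '' {Q | ringDeficit L z Q = 0 ∧ ∀ e : Edge 3 L, treeEdge e = true → Q.1 0 e = 1}) ≤ 1010 * (L : ℝ) ^ 6 * Dst Q := by
    intro Q hQ
    set τ : Site 3 L → SU2 := treeGauge (Q.1 0) with hτ
    have hmem : ((fun i => gaugeTransform τ (Q.1 i), τ * Q.2 * τ⁻¹) :
        (Fin (2 * L - 1 + 1) → GaugeConfig 3 L SU2) × (Site 3 L → SU2)) ∈
        {Q | ringDeficit L z Q = 0 ∧ ∀ e : Edge 3 L, treeEdge e = true → Q.1 0 e = 1} := by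
      refine ⟨?_, fun e he => ?_⟩
      · show ringDeficit L z _ = 0
        rw [ringDeficit_ringGaugeAct z τ Q]; exact hQ
      · exact treeFix_eq_one_of_treeEdge (Q.1 0) he
    refine (csInf_le hbddT ⟨_, hmem, rfl⟩).trans ?_
    exact ringDistSq_treeGauge_le P Q hP
  have hneZ : (Dst '' {Q | ringDeficit L z Q = 0}).Nonempty := hne.image _
  have h2 : sInf (Dst '' {Q | ringDeficit L z Q = 0 ∧ ∀ e : Edge 3 L, treeEdge e = true → Q.1 0 e = 1}) / (1010 * (L : ℝ) ^ 6) ≤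
      sInf (Dst '' {Q | ringDeficit L z Q = 0}) := by
    refine le_csInf hneZ ?_
    rintro _ ⟨Q, hQ, rfl⟩
    rw [div_le_iff₀ hc]
    linarith [hkey Q hQ]
  have h3 := (div_le_iff₀ hc).mp h2
  linarith

end Summit.QuantumFields.YangMills.Theorems.VirialFluxGap.RingDeficit
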